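/-
Copyright: width seat `ym-line-sll-p4` (prover-ym-line-sll-p4-g0-0), route `SoftLoopLongLag`, cruxes K′ `SoftLoopLagFloorToTorus`
(stmt-QuantumFields-22504) / T′ `ColdBoxSoftLoopLagFloor` (stmt-QuantumFields-24180), line `birth` — preliminaries of the N2-loops ASSEMBLY
(`…SoftLoopLongLagLoopMeanExpansion`): locality of the loop cost, near-centre geometry of the square, units, flux/inductance bounds.
-/
import Summits.QuantumFields.YangMills.Theorems.SoftLoopLongLagLoopKernelMeanDatumCore
import Summits.QuantumFields.YangMills.Theorems.SoftLoopLongLagBackgroundLoopFlux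
import Summits.QuantumFields.YangMills.Theorems.SoftLoopLongLagSurfaceFluxShiftedMeanD
import Summits.QuantumFields.YangMills.Theorems.SoftLoopLongLagInnerFlatSurfaceGauss
import Summits.QuantumFields.YangMills.Theorems.ColdBoxAllGroupsBulkAllGroupsUnitsInterfaceG
import Summits.QuantumFields.YangMills.Theorems.WeakCouplingRatesBulkDominatesColdBoxWKernelMeanPrelims

/-!
# Route `SoftLoopLongLag`, line `birth` (both cruxes), engine layer N2-loops: PRELIMINARIES of the loop mean-expansion assembly

Small lemmas consumed by `Theorems/SoftLoopLongLagLoopMeanExpansion.lean` (the loop twin of the sibling's `kernelMeanExpansionG_of_bounds`):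

* §1 locality of the loop: `lineHol_congr_of_eq`, `walkHolonomy_rectWalk_congr` — the `R×T` holonomy only sees the links `(y,k)` with
  `x ≤ y ≤ x + (R+T)` coordinatewise; `loopEdges_mem_boxEdgesAt` — for `x` within `H/8` (plus `R`) of the centre those links lie in the enlarged
  box `boxEdgesAt dirCorner (2H+3)`; hence `loopCost_eq_of_agree_enlarged` — the hypothesis shape `hXloc` of the kernel bridge
  `integral_boxKernelG_eq_of_gauge_trunc` for the loop cost.
* §2 `rectSurface_subset_plaquettesTouching` — the spanning surface of a near-centre square consists of plaquettes touching the cold box.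
* §3 units: `half_sum_sq_surfBackground_sdatE_eq` — `½Σ_c (Σ_{p∈S} F'_c(p))² = β·Σ_c (Σ_{p∈S} F̄I_c(p))²` (surface form of U1, `ϑI = (√2)⁻¹•ϑ`).
* §4 bounds: `abs_sum_dirBackground_le` (`|Σ_{p∈S} F'_c(p)| ≤ R²·R'`), `surfInductance_nonneg_le` (`0 ≤ V_S ≤ R⁴`, `|K| ≤ 1`),
  `sum_pow_four_add_sq_le` (`Σ_c (F_c⁴ + 3V²) ≤ D·((R²R')⁴ + 3R⁸)`).

No new definition; standard axioms.  HONEST LABEL: rung R2xi-G RECORD label (leaf `WeakCouplingRates.XiPow`, an UPPER bound on the lattice mass gap);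
NOT the Clay mass gap; no summit statement is touched.
-/

set_option autoImplicit false

noncomputable section

open MeasureTheory Finset Metric
open scoped ENNReal Matrix.Norms.Frobenius
open Literature.Probability.LatticeModels (Site zdGraph)
open Literature.MathematicalPhysics.QuantumLattice
open Literature.MathematicalPhysics.QuantumFieldTheory
open Literature.MathematicalPhysics.QuantumFieldTheory.LatticeMaxwell
open Literature.MathematicalPhysics.QuantumFieldTheory.AxialGauge
open Summit.QuantumFields.YangMills.Theorems.WeakCouplingRates
open Summit.QuantumFields.YangMills.Theorems.FreeEnergyLogCoefficient
open Summit.QuantumFields.YangMills.Theorems.ColdBoxAllGroups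

namespace Summit.QuantumFields.YangMills.Theorems.SoftLoopLongLag

/-! ## §1 Locality of the loop holonomy -/

section Locality

variable {G : Type} [Group G]

/-- `lineHol` only sees the links along the walk. -/
theorem lineHol_congr_of_eq {U V : LGConfig 4 G} (i : Fin 4) :
    ∀ (n : ℕ) (y : Site 4), (∀ s : ℕ, s < n → U (y + Pi.single i (s : ℤ), i) = V (y + Pi.single i (s : ℤ), i)) →
      lineHol U i n y = lineHol V i n y
  | 0, _, _ => rfl
  | n + 1, y, h => by
      rw [lineHol_succ, lineHol_succ]
      have h0 := h 0 (Nat.succ_pos n)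
      simp only [Nat.cast_zero, Pi.single_zero, add_zero] at h0
      rw [h0, lineHol_congr_of_eq i n (y + Pi.single i 1) fun s hs => ?_]
      have := h (s + 1) (Nat.succ_lt_succ hs)
      rwa [Nat.cast_succ, add_comm (s : ℤ) 1, Pi.single_add, ← add_assoc] at this

/-- **The rectangle holonomy only sees the links in the closed box `[x, x + (R+T)]⁴`** (coordinatewise). -/
theorem walkHolonomy_rectWalk_congr {U V : LGConfig 4 G} (x : Site 4) (i j : Fin 4) (R T : ℕ)
    (h : ∀ (y : Site 4) (k : Fin 4), (∀ m : Fin 4, x m ≤ y m ∧ y m ≤ x m + (R + T : ℕ)) → U (y, k) = V (y, k)) :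
    walkHolonomy U (rectWalk x i j R T) = walkHolonomy V (rectWalk x i j R T) := by
  have hin : ∀ (a b : ℕ), a ≤ R → b ≤ T → ∀ m : Fin 4,
      x m ≤ (x + Pi.single i (a : ℤ) + Pi.single j (b : ℤ) : Site 4) m ∧
        (x + Pi.single i (a : ℤ) + Pi.single j (b : ℤ) : Site 4) m ≤ x m + (R + T : ℕ) := by
    intro a b ha hb m
    have hi : (0 : ℤ) ≤ (Pi.single i (a : ℤ) : Site 4) m ∧ (Pi.single i (a : ℤ) : Site 4) m ≤ a := by
      simp only [Pi.single_apply]; split_ifs <;> constructor <;> omega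
    have hj : (0 : ℤ) ≤ (Pi.single j (b : ℤ) : Site 4) m ∧ (Pi.single j (b : ℤ) : Site 4) m ≤ b := by
      simp only [Pi.single_apply]; split_ifs <;> constructor <;> omega
    simp only [Pi.add_apply]
    push_cast
    constructor <;> omega
  have hA : lineHol U i R x = lineHol V i R x := lineHol_congr_of_eq i R x fun s hs => by
    have h' := hin s 0 hs.le (Nat.zero_le _)
    simp only [Nat.cast_zero, Pi.single_zero, add_zero] at h'
    exact h _ i h'
  have hB : lineHol U j T (x + Pi.single i (R : ℤ)) = lineHol V j T (x + Pi.single i (R : ℤ)) :=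
    lineHol_congr_of_eq j T _ fun s hs => h _ j (hin R s le_rfl hs.le)
  have hC : lineHol U i R (x + Pi.single j (T : ℤ)) = lineHol V i R (x + Pi.single j (T : ℤ)) :=
    lineHol_congr_of_eq i R _ fun s hs => by
      have := h _ i (by
        have h' := hin s T hs.le le_rfl
        rwa [add_right_comm] at h')
      exact this
  have hD : lineHol U j T x = lineHol V j T x := lineHol_congr_of_eq j T x fun s hs => by
    have h' := hin 0 s (Nat.zero_le _) hs.le
    simp only [Nat.cast_zero, Pi.single_zero, add_zero] at h'
    exact h _ j h'
  rw [Literature.MathematicalPhysics.QuantumLattice.walkHolonomy_rectWalk,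
    Literature.MathematicalPhysics.QuantumLattice.walkHolonomy_rectWalk, hA, hB, hC, hD]

/-- **The links of a near-centre square lie in the enlarged box**: if `‖x − boxCentre H‖ + (R+T) ≤ H/2` then every link `(y,k)` with
`x ≤ y ≤ x + (R+T)` coordinatewise belongs to `boxEdgesAt dirCorner (2H+3)`. -/
theorem loopEdges_mem_boxEdgesAt {H R T : ℕ} {x : Site 4} (hx : ‖x - boxCentre H‖ + (R + T : ℕ) ≤ (H : ℝ) / 2)
    {y : Site 4} (hy : ∀ m : Fin 4, x m ≤ y m ∧ y m ≤ x m + (R + T : ℕ)) (k : Fin 4) :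
    ((y, k) : Literature.MathematicalPhysics.QuantumLattice.ZdEdge 4) ∈ boxEdgesAt dirCorner (2 * H + 3) := by
  have hxm : ∀ m : Fin 4, |((x m : ℤ) : ℝ) - H| + (R + T : ℕ) ≤ (H : ℝ) / 2 := by
    intro m
    have h1 : ‖(x - boxCentre H) m‖ ≤ ‖x - boxCentre H‖ := norm_le_pi_norm _ m
    have h2 : ‖(x - boxCentre H) m‖ = |((x m : ℤ) : ℝ) - H| := by
      simp only [Pi.sub_apply, boxCentre, Int.norm_eq_abs, Int.cast_sub, Int.cast_natCast]
    linarith [h2 ▸ h1]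
  rw [mem_boxEdgesAt, mem_boxEdges_iff]
  have key : ∀ m : Fin 4, (0 : ℤ) ≤ y m - dirCorner m ∧ y m - dirCorner m < (2 * H + 3 : ℕ) ∧
      (m = k → y m - dirCorner m + 1 < (2 * H + 3 : ℕ)) := by
    intro m
    have h := hxm m
    have hRT : (0 : ℝ) ≤ (R + T : ℕ) := Nat.cast_nonneg _
    have hle := le_abs_self (((x m : ℤ) : ℝ) - H)
    have hge := neg_abs_le (((x m : ℤ) : ℝ) - H)
    obtain ⟨hy1, hy2⟩ := hy m
    have hy1' : ((x m : ℤ) : ℝ) ≤ ((y m : ℤ) : ℝ) := by exact_mod_cast hy1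
    have hy2' : ((y m : ℤ) : ℝ) ≤ ((x m : ℤ) : ℝ) + (R + T : ℕ) := by exact_mod_cast hy2
    have hlo : (0 : ℝ) ≤ ((y m : ℤ) : ℝ) := by linarith
    have hhi : ((y m : ℤ) : ℝ) ≤ 3 * (H : ℝ) / 2 := by linarith
    have hlo' : (0 : ℤ) ≤ y m := by exact_mod_cast hlo
    have hhi' : 2 * y m ≤ 3 * (H : ℤ) := by
      have : (2 : ℝ) * ((y m : ℤ) : ℝ) ≤ 3 * (H : ℝ) := by linarith
      exact_mod_cast this
    simp only [dirCorner, sub_neg_eq_add]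
    push_cast
    refine ⟨by omega, by omega, fun _ => by omega⟩
  refine ⟨fun m => ⟨(key m).1, (key m).2.1⟩, ?_⟩
  simpa using (key k).2.2 rfl

variable {N : ℕ} (ρ : G →* Matrix (Fin N) (Fin N) ℂ)

/-- **Locality of the loop cost on the enlarged box** (the shape `hXloc` of the kernel bridge `integral_boxKernelG_eq_of_gauge_trunc`): for
`‖x − boxCentre H‖ + (R+T) ≤ H/2`, two configurations agreeing on `boxEdgesAt dirCorner (2H+3)` have the same `R×T` loop cost at `x`. -/
theorem loopCost_eq_of_agree_enlarged {H R T : ℕ} {x : Site 4} (hx : ‖x - boxCentre H‖ + (R + T : ℕ) ≤ (H : ℝ) / 2) (β : ℝ)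
    (U U' : LGConfig 4 G) (hUU' : ∀ e ∈ boxEdgesAt dirCorner (2 * H + 3), U e = U' e) :
    β * ((N : ℝ) - (ρ (walkHolonomy U (rectWalk x 1 2 R T))).trace.re) =
      β * ((N : ℝ) - (ρ (walkHolonomy U' (rectWalk x 1 2 R T))).trace.re) := by
  rw [walkHolonomy_rectWalk_congr x 1 2 R T fun y k hy => hUU' _ (loopEdges_mem_boxEdgesAt hx hy k)]

end Locality

/-! ## §2 The spanning surface of a near-centre square touches the cold box -/

/-- Membership in `rectSurface`: the plaquette is `(x + a e₁ + b e₂; 1, 2)` with `a < R`, `b < T`. -/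
theorem mem_rectSurface_iff {x : Site 4} {R T : ℕ} {p : ZdPlaquette 4} :
    p ∈ rectSurface x R T ↔ ∃ a b : ℕ, a < R ∧ b < T ∧
      p = ((x + Pi.single 1 (a : ℤ) + Pi.single 2 (b : ℤ), ⟨((1 : Fin 4), (2 : Fin 4)), by decide⟩) : ZdPlaquette 4) := by
  unfold rectSurface
  simp only [Finset.mem_image, Finset.mem_product, Finset.mem_range, Prod.exists]
  constructor
  · rintro ⟨a, b, ⟨ha, hb⟩, rfl⟩; exact ⟨a, b, ha, hb, rfl⟩
  · rintro ⟨a, b, ha, hb, rfl⟩; exact ⟨a, b, ⟨ha, hb⟩, rfl⟩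

/-- **The spanning surface of a near-centre square consists of plaquettes touching the cold box** (`‖x − boxCentre H‖ + R ≤ H/8`, `H ≥ 1`). -/
theorem rectSurface_subset_plaquettesTouching {H R : ℕ} (hH : 1 ≤ H) {x : Site 4} (hx : ‖x - boxCentre H‖ + R ≤ (H : ℝ) / 8) :
    ∀ p ∈ rectSurface x R R, p ∈ plaquettesTouching (AxialGauge.boxEdges 4 (2 * H + 1)) := by
  intro p hp
  have hnear := int_near_of_norm_sub_boxCentre_le (rectSurface_near_centre hx p hp)
  obtain ⟨a, b, -, -, rfl⟩ := mem_rectSurface_iff.1 hp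
  exact near_centre_mem_plaquettesTouching hH hnear

/-! ## §3 Units: the surface form of U1 -/

/-- **(U1, surface form)** `½Σ_c (Σ_{p∈S} F'_c(p))² = β·Σ_c (Σ_{p∈S} F̄I_c(p))²`, `F'` the background of the scaled datum `sdatE β ϑ`, `F̄I` that of
`ϑI = (√2)⁻¹•ϑ` (`β ≥ 0`). -/
theorem half_sum_sq_surfBackground_sdatE_eq {H D : ℕ} {β : ℝ} (hβ : 0 ≤ β)
    (ϑ : Fin D → Literature.MathematicalPhysics.QuantumLattice.ZdEdge 4 → ℝ) (S : Finset (Plaq 4)) :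
    1 / 2 * (∑ c, (∑ q ∈ S, sCirc (glue (pin := fun e => e ∉ dirFreeEdges H) dirCorner (2 * H + 3) (sdatE β ϑ c)
        (mean (fun e => e ∉ dirFreeEdges H) dirCorner (2 * H + 3) (sdatE β ϑ c))) q) ^ 2) =
      β * (∑ c, (∑ q ∈ S, sCirc (glue (pin := fun e => e ∉ dirFreeEdges H) dirCorner (2 * H + 3) ((Real.sqrt 2)⁻¹ • ϑ c)
        (mean (fun e => e ∉ dirFreeEdges H) dirCorner (2 * H + 3) ((Real.sqrt 2)⁻¹ • ϑ c))) q) ^ 2) := by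
  have hβ2 : Real.sqrt β ^ 2 = β := Real.sq_sqrt hβ
  simp_rw [dirBackground_sdatE_eq, sCirc_glue_smul_mean ((Real.sqrt 2)⁻¹), ← Finset.mul_sum, mul_pow, hβ2, sqrt_two_inv_sq]
  rw [← Finset.mul_sum, ← Finset.mul_sum]; ring

/-! ## §4 Flux and inductance bounds on a square -/

/-- **Background flux bound**: if every background circulation satisfies `|F'_c(p)| ≤ R'` then `|Σ_{p∈S(x)} F'_c(p)| ≤ R²·R'`. -/
theorem abs_sum_rectSurface_le {R : ℕ} {x : Site 4} {F : ZdPlaquette 4 → ℝ} {R' : ℝ} (hF : ∀ p, |F p| ≤ R') :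
    |∑ p ∈ rectSurface x R R, F p| ≤ (R : ℝ) ^ 2 * R' := by
  have hR'0 : 0 ≤ R' := (abs_nonneg _).trans (hF ((x, ⟨((1 : Fin 4), (2 : Fin 4)), by decide⟩) : ZdPlaquette 4))
  refine (Finset.abs_sum_le_sum_abs _ _).trans ((Finset.sum_le_card_nsmul _ _ _ fun p _ => hF p).trans ?_)
  rw [nsmul_eq_mul]
  have hcard : ((rectSurface x R R).card : ℝ) ≤ (R : ℝ) ^ 2 := by
    have := card_rectSurface_le x R R
    calc ((rectSurface x R R).card : ℝ) ≤ ((R * R : ℕ) : ℝ) := by exact_mod_cast this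
      _ = (R : ℝ) ^ 2 := by push_cast; ring
  exact mul_le_mul_of_nonneg_right hcard hR'0

/-- **Dirichlet loop variance bounds**: `0 ≤ V_S ≤ R⁴` for `V_S = Σ_{p,q∈S(x)} boxDirProjKernel H p q` (every kernel entry is `≤ 1` in absolute value;
nonnegativity as a variance). -/
theorem surfInductance_nonneg_le (H R : ℕ) (x : Site 4) :
    0 ≤ ∑ p ∈ rectSurface x R R, ∑ q ∈ rectSurface x R R,
        boxDirProjKernel H ((p.1, p.2.1.1, p.2.1.2) : Plaq 4) ((q.1, q.2.1.1, q.2.1.2) : Plaq 4) ∧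
      ∑ p ∈ rectSurface x R R, ∑ q ∈ rectSurface x R R,
        boxDirProjKernel H ((p.1, p.2.1.1, p.2.1.2) : Plaq 4) ((q.1, q.2.1.1, q.2.1.2) : Plaq 4) ≤ (R : ℝ) ^ 4 := by
  constructor
  · rw [← dirSurfInductance_loopSurf]; exact dirSurfInductance_self_nonneg _
  · have hcard : ((rectSurface x R R).card : ℝ) ≤ (R : ℝ) ^ 2 := by
      have := card_rectSurface_le x R R
      calc ((rectSurface x R R).card : ℝ) ≤ ((R * R : ℕ) : ℝ) := by exact_mod_cast this
        _ = (R : ℝ) ^ 2 := by push_cast; ring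
    have hinner : ∀ p ∈ rectSurface x R R, ∑ q ∈ rectSurface x R R,
        boxDirProjKernel H ((p.1, p.2.1.1, p.2.1.2) : Plaq 4) ((q.1, q.2.1.1, q.2.1.2) : Plaq 4) ≤ (R : ℝ) ^ 2 := by
      intro p _
      refine (Finset.sum_le_card_nsmul _ _ 1 fun q _ => (le_abs_self _).trans (abs_boxDirProjKernel_le_one p q)).trans ?_
      rw [nsmul_eq_mul, mul_one]; exact hcard
    refine (Finset.sum_le_card_nsmul _ _ _ hinner).trans ?_
    rw [nsmul_eq_mul]
    calc ((rectSurface x R R).card : ℝ) * (R : ℝ) ^ 2 ≤ (R : ℝ) ^ 2 * (R : ℝ) ^ 2 := mul_le_mul_of_nonneg_right hcard (by positivity)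
      _ = (R : ℝ) ^ 4 := by ring

/-- **The loop fourth-moment constant**: with `|F_c| ≤ A` and `0 ≤ V ≤ R⁴`, `Σ_c (F_c⁴ + 3V²) ≤ D·(A⁴ + 3R⁸)`. -/
theorem sum_pow_four_add_sq_le {D : ℕ} {F : Fin D → ℝ} {A V Rr : ℝ} (hF : ∀ c, |F c| ≤ A) (hV0 : 0 ≤ V) (hV : V ≤ Rr ^ 4) :
    ∑ c, (F c ^ 4 + 3 * V ^ 2) ≤ (D : ℝ) * (A ^ 4 + 3 * Rr ^ 8) := by
  have hterm : ∀ c ∈ (Finset.univ : Finset (Fin D)), F c ^ 4 + 3 * V ^ 2 ≤ A ^ 4 + 3 * Rr ^ 8 := by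
    intro c _
    have h1 : F c ^ 4 ≤ A ^ 4 := by
      rw [show F c ^ 4 = |F c| ^ 4 by rw [pow_abs, abs_of_nonneg (by positivity)]]
      exact pow_le_pow_left₀ (abs_nonneg _) (hF c) 4
    have h2 : V ^ 2 ≤ Rr ^ 8 := by
      calc V ^ 2 ≤ (Rr ^ 4) ^ 2 := pow_le_pow_left₀ hV0 hV 2
        _ = Rr ^ 8 := by ring
    linarith
  refine (Finset.sum_le_card_nsmul _ _ _ hterm).trans ?_
  rw [Finset.card_univ, Fintype.card_fin, nsmul_eq_mul]

end Summit.QuantumFields.YangMills.Theorems.SoftLoopLongLag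

end
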